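import Summits.QuantumFields.BalabanUV.Beta.GAN24.WoodburyFibre
import Summits.QuantumFields.BalabanUV.Beta.GAN24.DirichletExhaustionCoerDict
import Summits.QuantumFields.BalabanUV.Beta.GAN24.MonotoneCauchy
import Literature.MathematicalPhysics.QuantumFieldTheory.Balaban1983to89.Beta.MonotoneScales

/-!
# Beta / GAN24 / MonotoneMultiplier — the MULTIPLIER BLOCK of the wall's resolvent slot on the MONOTONE road: Bałaban's `Δ_k` on `ℤ^{d+1}` is
# FORM-MONOTONE in `k` (asym1's torus theorem de-periodised), hence (MONO-K)₂ for the `mm` block from p3's dictionary and ONE diagonal datum — NO rate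
# (gan24-p4 gen 2, node P4-N8 of `HOME/b2b-balaban-gan24-p4/SKELETON-P4.md`; BINDER-OWNERS row G-an2-4 ∕ (CONV-C), «rate OR monotonicity»; NOT IN PRINT — our proof attempt)

HONEST FRAMING (page 1 of everything the β sub-cell writes): discharging `BetaPertH` makes Bałaban's UV stability UNCONDITIONAL — a
real constructive-QFT result; it is NOT the continuum limit and NOT the Clay problem.  HONEST DEPENDENCY (cell reorg 2026-08-19, verbatim):
«continuum YM on T⁴ ⇐ BetaPertH ∧ nine spine estimates (0/9 proved); BetaPertH ⇐ (D1) ∧ (D4) ∧ CAP+tail; G-an2-4 gates asym, D1 and NE2/3/4.»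
HONEST LABEL: «not in print; our proof attempt; alternative discharge of the G-an2-4 row (rate OR monotonicity)»; 0 wall binders instantiated.
ABSOLUTE RULE honoured: nothing printed enters as a hypothesis; [folklore] real analysis over tree theorems BY NAME — asym1 `Beta.MonotoneScales.formDk_mono_of_dvd`
(the (1.66) form increases along `n ∣ n′`, tori), pv09∕b06 `B6Cov2156Torus.represents_deltaPol` (the torus matrix `deltaPol` represents that form), gan24-p2
`DirichletExhaustionTails.deltaPol_sub_deltaZ_abs_le` (`deltaPol → deltaZ` entrywise as the torus grows), gan24-p3 `WoodburyFibre.MultDict` (a binder SHAPE, the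
an2↔b05 junction; asserted of nothing here).

WHAT IS PROVED.  §1 `deltaPol_form_mono`: on every torus, `B ↦ Σ B·deltaPol M (L^k)·B` is non-decreasing in `k`.  §2 `deltaZ_form_mono`: for every finitely supported
real bond field `B` on `ℤ^{d+1}`, `k ↦ Σ_{x,y} B x · deltaZ L k x y · B y` is non-decreasing (de-periodisation: shift into a box, compare on the torus of side `M₀`,
let `M₀ → ∞`).  §3 PSD-kernel domination: a symmetric kernel with non-negative two-point forms has `|W x y| ≤ (W x x + W y y)/2`; for `deltaZ L k′ − deltaZ L k`
(`k ≤ k′`) the diagonal is translation invariant, so EVERY entry of the increment is bounded by the largest diagonal increment `max_κ (d k′ κ − d k κ)`,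
`d k κ := deltaZ L k (0,κ) (0,κ)` non-decreasing and bounded (`deltaZ_abs_le`).  §4 **`supCauchyBand_blockMM_of_multDict`**: p3's `MultDict Lc c` + ONE DATUM
`d (j+1) κ − d (k₀+1) κ ≤ η₀` (`j ≥ k₀`, all `κ`; certifiable against the supremum `⨆_j d j κ`, `diag_le_ciSup`) ⟹ `SupCauchyBand (j ↦ blockMM (unitResolvent Lc j)) (|c|·η₀) k₀`
— (MONO-K)₂ for the multiplier block with NO rate and NO symbolic constant (cf. p3's RATE version `decays_blockMM_sub_of_multDict`).  NOT BetaPertH, NOT continuum, NOT Clay.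
-/

noncomputable section

open Finset Filter Topology Matrix
open scoped BigOperators
open Literature.MathematicalPhysics.QuantumFieldTheory.Balaban1983to89
open B6Lemma24Torus (pbox mem_pbox)
open B6Cov2156Torus (deltaPol represents_deltaPol ofBox quad_eq_sum_sum)
open B5Bounds167Lattice (ofRealCfg formDk)
open B4Sect5Exhaustion (K)
open Summit.QuantumFields.BalabanUV.Beta.GAN24.DirichletExhaustionDeltaZ (deltaZ c166Z kappaZ kappaZ_pos deltaZ_abs_le)
open Summit.QuantumFields.BalabanUV.Beta.GAN24.DirichletExhaustionDeltaZSymm (deltaZ_symm)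
open Summit.QuantumFields.BalabanUV.Beta.GAN24.DirichletExhaustionTails (tailConst deltaPol_sub_deltaZ_abs_le)
open Summit.QuantumFields.BalabanUV.Beta.GAN24.DirichletExhaustionCoerDict (deltaZ_translate_sub sum_box_translate exists_coord_bound sum_sum_mul_le)
open Summit.QuantumFields.BalabanUV.Beta.GAN24.WoodburyFibreBlocks (blockMM)
open Summit.QuantumFields.BalabanUV.Beta.GAN24.WoodburyFibre (MultDict unitResolvent_inr_inr_coarse unitResolvent_inr_inr_off_left unitResolvent_inr_inr_off_right)
open Summit.QuantumFields.BalabanUV.Beta.PropagatorWoodburyFibreTarget (unitResolvent)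
open Summit.QuantumFields.BalabanUV.Beta.GAN24.MonotoneCauchy (SupCauchyBand)
open Summit.QuantumFields.BalabanUV.Beta.GAN24.CombesThomas (SupBound)
open Literature.Probability.LatticeModels (Torus.proj)
open Literature.MathematicalPhysics.QuantumFieldTheory.Balaban1983to89.Beta.OneStepResolventKernel (eq_zsmul_quo_of_proj)
open Literature.MathematicalPhysics.QuantumFieldTheory.LatticeForm (quo)

namespace Summit.QuantumFields.BalabanUV.Beta.GAN24.MonotoneMultiplier

variable {d : ℕ}

/-! ## §1 On the torus: the (1.66) matrix is form-monotone in `k` (asym1 + the pv09 representation) -/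

/-- **`deltaPol` IS FORM-MONOTONE IN `k` ON EVERY TORUS**: `Σ_p B p (deltaPol M (L^k) B) p ≤ Σ_p B p (deltaPol M (L^{k+1}) B) p` for every real bond field
`B` — `represents_deltaPol` (the sum IS `formDk (L^k) M (…)`) + asym1's `formDk_mono_of_dvd` (`L^k ∣ L^{k+1}`). [folklore] -/
theorem deltaPol_form_mono (M : Fin d → ℕ) [∀ μ, NeZero (M μ)] (L : ℕ) [NeZero L] (k : ℕ) (B : B4.Idx (pbox M) d → ℝ) :
    ∑ p, B p * (deltaPol M (L ^ k) *ᵥ B) p ≤ ∑ p, B p * (deltaPol M (L ^ (k + 1)) *ᵥ B) p := by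
  rw [represents_deltaPol M (L ^ k) B, represents_deltaPol M (L ^ (k + 1)) B]
  exact Beta.MonotoneScales.formDk_mono_of_dvd M (pow_dvd_pow L (Nat.le_succ k)) _

/-! ## §2 On `ℤ^{d+1}`: `deltaZ` is form-monotone in `k` (torus exhaustion, gan24-p2's PART 13/16 bookkeeping BY NAME) -/

/-- `0 ≤ tailConst d` (read off gan24-p2's bound at one point). [folklore] -/
theorem tailConst_nonneg : 0 ≤ tailConst d := by
  unfold tailConst DirichletExhaustionDeltaZ.c166Z
  have := B5Symbol166Strip.MG_pos (d + 1)
  have := B4Sect5Proof.latticeConst_nonneg (d + 1) (kappaZ_pos d).le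
  positivity

/-- **BAŁABAN'S `Δ_k` ON `ℤ^{d+1}` IS FORM-MONOTONE IN `k`**: for every `w` vanishing off a finite `R`,
`Σ_{r,s∈R} w_r·deltaZ L k r s·w_s ≤ Σ_{r,s∈R} w_r·deltaZ L (k+1) r s·w_s`.  Proof: translate `R` into the box of the torus `N^{d+1}`, compare the
two torus forms by `deltaPol_form_mono`, control both wrap-around errors by gan24-p2's `deltaPol_sub_deltaZ_abs_le` (`O(e^{−κZ(N−1)})`), let `N → ∞`
(the ε-argument of gan24-p2's `lower2153_Z`, verbatim in structure). [folklore] -/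
theorem deltaZ_form_mono (L : ℕ) [NeZero L] (k : ℕ) (R : Finset (K (d + 1) (d + 1))) (w : K (d + 1) (d + 1) → ℝ)
    (hsupp : ∀ r, r ∉ R → w r = 0) :
    ∑ r ∈ R, ∑ s ∈ R, w r * deltaZ L k r s * w s ≤ ∑ r ∈ R, ∑ s ∈ R, w r * deltaZ L (k + 1) r s * w s := by
  classical
  have hκ := kappaZ_pos d
  obtain ⟨A, hA⟩ := exists_coord_bound R
  obtain ⟨t, ht_def⟩ : ∃ t : Fin (d + 1) → ℤ, ∀ i, t i = (A : ℤ) + 1 := ⟨fun _ => (A : ℤ) + 1, fun _ => rfl⟩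
  set Cst : ℝ := 2 * (tailConst d * Real.exp (kappaZ d * (2 * (A : ℝ))) * (∑ r ∈ R, |w r|) ^ 2) with hCst
  have hCst0 : 0 ≤ Cst := by
    rw [hCst]
    have := tailConst_nonneg (d := d)
    positivity
  -- THE KEY INEQUALITY ON EVERY LARGE TORUS
  have key : ∀ N : ℕ, 2 * A + 3 ≤ N →
      ∑ r ∈ R, ∑ s ∈ R, w r * deltaZ L k r s * w s ≤
        (∑ r ∈ R, ∑ s ∈ R, w r * deltaZ L (k + 1) r s * w s) + Cst * Real.exp (-(kappaZ d * ((N : ℝ) - 1))) := by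
    intro N hN
    have hN1 : 1 ≤ N := by omega
    obtain ⟨M, hM⟩ : ∃ M : Fin (d + 1) → ℕ, ∀ i, M i = N := ⟨fun _ => N, fun _ => rfl⟩
    have hMpos : ∀ i, 0 < M i := fun i => by rw [hM i]; omega
    haveI : ∀ μ, NeZero (M μ) := fun μ => ⟨(hMpos μ).ne'⟩
    have hMN : ∀ i, N ≤ M i := fun i => (hM i).ge
    -- the translated support lies in the box
    have hcoord : ∀ r ∈ R, ∀ i, (0 : ℤ) ≤ (r.1 + t) i ∧ (r.1 + t) i < (M i : ℤ) := by
      intro r hr i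
      have h := hA r hr i
      rw [abs_le] at h
      rw [Pi.add_apply, ht_def i, hM i]
      have hN' : 2 * (A : ℤ) + 3 ≤ N := by exact_mod_cast hN
      constructor <;> linarith [h.1, h.2]
    have hbox : ∀ r ∈ R, r.1 + t ∈ pbox M := fun r hr => mem_pbox.2 fun i => hcoord r hr i
    -- the box field `B b = w(b₋ − t, ν)`
    obtain ⟨B, hB⟩ : ∃ B : B4.Idx (pbox M) (d + 1) → ℝ, ∀ b, B b = w (((b.1 : Fin (d + 1) → ℤ) - t), b.2) :=
      ⟨_, fun _ => rfl⟩
    have hBsupp : ∀ b : B4.Idx (pbox M) (d + 1), B b ≠ 0 →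
        ((((b.1 : Fin (d + 1) → ℤ) - t), b.2) : K (d + 1) (d + 1)) ∈ R := by
      intro b hb
      by_contra h
      exact hb (by rw [hB]; exact hsupp _ h)
    -- (i) monotonicity on the torus
    have hmono := deltaPol_form_mono M L k B
    rw [quad_eq_sum_sum, quad_eq_sum_sum] at hmono
    -- (ii) the main terms: the box double sums of `deltaZ` are the `R × R` double sums
    have hmain : ∀ k' : ℕ, ∑ b : B4.Idx (pbox M) (d + 1), ∑ b' : B4.Idx (pbox M) (d + 1),
        B b * B b' * deltaZ L k' ((b.1 : Fin (d + 1) → ℤ), b.2) ((b'.1 : Fin (d + 1) → ℤ), b'.2) =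
        ∑ r ∈ R, ∑ s ∈ R, w r * deltaZ L k' r s * w s := by
      intro k'
      have inner : ∀ b : B4.Idx (pbox M) (d + 1), ∑ b' : B4.Idx (pbox M) (d + 1),
          B b * B b' * deltaZ L k' ((b.1 : Fin (d + 1) → ℤ), b.2) ((b'.1 : Fin (d + 1) → ℤ), b'.2) =
          ∑ s ∈ R, w (((b.1 : Fin (d + 1) → ℤ) - t), b.2) * deltaZ L k' (((b.1 : Fin (d + 1) → ℤ) - t), b.2) s * w s := by
        intro b
        rw [← sum_box_translate t R
          (fun s => w (((b.1 : Fin (d + 1) → ℤ) - t), b.2) * deltaZ L k' (((b.1 : Fin (d + 1) → ℤ) - t), b.2) s * w s)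
          (fun s hs => by simp only [hsupp s hs, mul_zero]) hbox]
        refine Finset.sum_congr rfl fun b' _ => ?_
        rw [hB, hB, deltaZ_translate_sub]
        ring
      rw [Finset.sum_congr rfl fun b _ => inner b]
      exact sum_box_translate t R (fun r => ∑ s ∈ R, w r * deltaZ L k' r s * w s)
        (fun r hr => Finset.sum_eq_zero fun s _ => by simp only [hsupp r hr, zero_mul]) hbox
    -- (iii) the wrap-around tails (both exponents)
    have hdist : ∀ b b' : B4.Idx (pbox M) (d + 1), B b ≠ 0 → B b' ≠ 0 →
        dist (b.1 : Fin (d + 1) → ℤ) (b'.1 : Fin (d + 1) → ℤ) ≤ 2 * (A : ℝ) := by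
      intro b b' hb hb'
      have hr := hA _ (hBsupp b hb)
      have hs := hA _ (hBsupp b' hb')
      refine (dist_pi_le_iff (by positivity)).2 fun i => ?_
      rw [Int.dist_eq]
      have h1 := hr i
      have h2 := hs i
      simp only [Pi.sub_apply] at h1 h2
      rw [abs_le] at h1 h2 ⊢
      obtain ⟨h1a, h1b⟩ := h1
      obtain ⟨h2a, h2b⟩ := h2
      have e1 := (Int.cast_le (R := ℝ)).2 h1a
      have e2 := (Int.cast_le (R := ℝ)).2 h1b
      have e3 := (Int.cast_le (R := ℝ)).2 h2a
      have e4 := (Int.cast_le (R := ℝ)).2 h2b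
      push_cast at e1 e2 e3 e4
      constructor <;> linarith
    set E : ℝ := tailConst d * Real.exp (kappaZ d * (2 * (A : ℝ))) * Real.exp (-(kappaZ d * ((N : ℝ) - 1))) with hE
    have hXY : ∀ (k' : ℕ) (p q : B4.Idx (pbox M) (d + 1)), B p ≠ 0 → B q ≠ 0 →
        |deltaPol M (L ^ k') p q - deltaZ L k' ((p.1 : Fin (d + 1) → ℤ), p.2) ((q.1 : Fin (d + 1) → ℤ), q.2)| ≤ E := by
      intro k' p q hp hq
      refine (deltaPol_sub_deltaZ_abs_le L k' M hN1 hMN p q).trans ?_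
      have h1 : Real.exp (kappaZ d * dist (p.1 : Fin (d + 1) → ℤ) (q.1 : Fin (d + 1) → ℤ)) ≤
          Real.exp (kappaZ d * (2 * (A : ℝ))) :=
        Real.exp_le_exp.2 (mul_le_mul_of_nonneg_left (hdist p q hp hq) hκ.le)
      exact mul_le_mul_of_nonneg_right (mul_le_mul_of_nonneg_left h1 tailConst_nonneg) (Real.exp_pos _).le
    -- `Z_k ≤ T_k + E S²` and `T_{k+1} ≤ Z_{k+1} + E S²`
    have h1 := sum_sum_mul_le B
      (fun p q => deltaZ L k ((p.1 : Fin (d + 1) → ℤ), p.2) ((q.1 : Fin (d + 1) → ℤ), q.2))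
      (fun p q => deltaPol M (L ^ k) p q) (E := E)
      (fun p q hp hq => by rw [abs_sub_comm]; exact hXY k p q hp hq)
    have h2 := sum_sum_mul_le B (fun p q => deltaPol M (L ^ (k + 1)) p q)
      (fun p q => deltaZ L (k + 1) ((p.1 : Fin (d + 1) → ℤ), p.2) ((q.1 : Fin (d + 1) → ℤ), q.2)) (E := E)
      (fun p q hp hq => hXY (k + 1) p q hp hq)
    have habs : ∑ b : B4.Idx (pbox M) (d + 1), |B b| = ∑ r ∈ R, |w r| := by
      simp only [hB]
      exact sum_box_translate t R (fun r => |w r|) (fun r hr => by simp only [hsupp r hr, abs_zero]) hbox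
    rw [hmain k, habs] at h1
    rw [hmain (k + 1), habs] at h2
    have hEC : E * (∑ r ∈ R, |w r|) ^ 2 + E * (∑ r ∈ R, |w r|) ^ 2 = Cst * Real.exp (-(kappaZ d * ((N : ℝ) - 1))) := by
      rw [hCst, hE]; ring
    linarith [hmono, h1, h2, hEC]
  -- `N → ∞`
  refine le_of_forall_pos_lt_add fun ε hε => ?_
  obtain ⟨N₁, hN₁⟩ := exists_nat_gt (Cst / ε / kappaZ d + 1)
  have hkey := key (max (2 * A + 3) N₁) (le_max_left _ _)
  set x : ℝ := kappaZ d * (((max (2 * A + 3) N₁ : ℕ) : ℝ) - 1) with hx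
  have hNx : Cst / ε < x + 1 := by
    have h1 : (N₁ : ℝ) ≤ ((max (2 * A + 3) N₁ : ℕ) : ℝ) := by exact_mod_cast le_max_right _ _
    have h3 : Cst / ε / kappaZ d < (((max (2 * A + 3) N₁ : ℕ) : ℝ)) - 1 := by linarith
    have h4 := (div_lt_iff₀ hκ).1 h3
    rw [hx]; linarith
  have hx0 : 0 ≤ x := by
    rw [hx]
    have : (1 : ℝ) ≤ (((max (2 * A + 3) N₁ : ℕ) : ℝ)) := by
      have : 1 ≤ max (2 * A + 3) N₁ := le_trans (by omega) (le_max_left _ _)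
      exact_mod_cast this
    exact mul_nonneg hκ.le (by linarith)
  have hexp : Real.exp (-x) ≤ 1 / (x + 1) := by
    rw [Real.exp_neg, one_div]
    exact inv_anti₀ (by linarith) (by linarith [Real.add_one_le_exp x])
  have htail : Cst * Real.exp (-x) < ε := by
    calc Cst * Real.exp (-x) ≤ Cst * (1 / (x + 1)) := mul_le_mul_of_nonneg_left hexp hCst0
      _ = Cst / (x + 1) := by ring
      _ < ε := by
          rw [div_lt_iff₀ (by linarith)]
          calc Cst = ε * (Cst / ε) := by field_simp
            _ < ε * (x + 1) := mul_lt_mul_of_pos_left hNx hε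
  linarith

/-- … iterated: `k ≤ k′ ⟹ Σ w·deltaZ L k·w ≤ Σ w·deltaZ L k′·w`. [folklore] -/
theorem deltaZ_form_mono_of_le (L : ℕ) [NeZero L] {k k' : ℕ} (hk : k ≤ k') (R : Finset (K (d + 1) (d + 1)))
    (w : K (d + 1) (d + 1) → ℝ) (hsupp : ∀ r, r ∉ R → w r = 0) :
    ∑ r ∈ R, ∑ s ∈ R, w r * deltaZ L k r s * w s ≤ ∑ r ∈ R, ∑ s ∈ R, w r * deltaZ L k' r s * w s := by
  induction k', hk using Nat.le_induction with
  | base => exact le_rfl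
  | succ n _ ih => exact ih.trans (deltaZ_form_mono L n R w hsupp)

/-! ## §3 PSD-kernel domination: every entry of a monotone increment is bounded by the diagonal increments -/

section PSD

variable {ι : Type*} [DecidableEq ι]

/-- The double sum of a two-point test vector `w = δ_x + σ·δ_y` (`x ≠ y`) against a kernel `W`. [folklore] -/
theorem sum_sum_pair (W : ι → ι → ℝ) {x y : ι} (hxy : x ≠ y) (σ : ℝ) :
    ∑ r ∈ ({x, y} : Finset ι), ∑ s ∈ ({x, y} : Finset ι),
        (if r = x then 1 else if r = y then σ else 0) * W r s * (if s = x then 1 else if s = y then σ else 0) =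
      W x x + σ * W x y + σ * W y x + σ * σ * W y y := by
  have hyx : y ≠ x := fun h => hxy h.symm
  rw [Finset.sum_pair hxy, Finset.sum_pair hxy, Finset.sum_pair hxy]
  simp only [if_true, if_false, hyx]
  ring

/-- **A SYMMETRIC KERNEL WITH NON-NEGATIVE FINITELY SUPPORTED FORMS IS ENTRYWISE DOMINATED BY ITS DIAGONAL**:
`|W x y| ≤ (W x x + W y y)/2` (test vectors `δ_x ± δ_y`). [folklore] -/
theorem abs_le_half_diag (W : ι → ι → ℝ) (hsymm : ∀ x y, W x y = W y x)
    (hpsd : ∀ (R : Finset ι) (w : ι → ℝ), (∀ r, r ∉ R → w r = 0) → 0 ≤ ∑ r ∈ R, ∑ s ∈ R, w r * W r s * w s)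
    (x y : ι) : |W x y| ≤ (W x x + W y y) / 2 := by
  by_cases hxy : x = y
  · subst hxy
    have h := hpsd {x} (fun r => if r = x then 1 else 0) (fun r hr => by
      rw [Finset.mem_singleton] at hr; simp [hr])
    simp only [Finset.sum_singleton, if_true, one_mul, mul_one] at h
    rw [abs_of_nonneg h]
    linarith
  · have hσ : ∀ σ : ℝ, σ = 1 ∨ σ = -1 → 0 ≤ W x x + σ * W x y + σ * W y x + σ * σ * W y y := by
      intro σ hσ
      have h := hpsd {x, y} (fun r => if r = x then 1 else if r = y then σ else 0) (fun r hr => by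
        simp only [Finset.mem_insert, Finset.mem_singleton, not_or] at hr
        simp [hr.1, hr.2])
      rwa [sum_sum_pair W hxy σ] at h
    have h1 := hσ 1 (Or.inl rfl)
    have h2 := hσ (-1) (Or.inr rfl)
    rw [hsymm y x] at h1 h2
    rw [abs_le]
    constructor <;> nlinarith

end PSD

/-! ## §4 The multiplier block of the wall's slot: (MONO-K)₂ from p3's dictionary and ONE diagonal datum -/

/-- The DIAGONAL of `Δ_k` on `ℤ^{d+1}`: `dDiag L k κ := deltaZ L k (0,κ) (0,κ)` (translation invariant: `deltaZ_diag_eq`). [folklore] -/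
def dDiag (L : ℕ) [NeZero L] (k : ℕ) (κ : Fin (d + 1)) : ℝ :=
  deltaZ L k ((0 : Fin (d + 1) → ℤ), κ) ((0 : Fin (d + 1) → ℤ), κ)

/-- Translation invariance of the diagonal: `deltaZ L k (x,κ) (x,κ) = dDiag L k κ`. [folklore] -/
theorem deltaZ_diag_eq (L : ℕ) [NeZero L] (k : ℕ) (x : Fin (d + 1) → ℤ) (κ : Fin (d + 1)) :
    deltaZ L k (x, κ) (x, κ) = dDiag L k κ := by
  have h := deltaZ_translate_sub L k x x x κ κ
  rw [sub_self] at h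
  exact h.symm

/-- The form of `deltaZ L k′ − deltaZ L k` (`k ≤ k′`) is non-negative on finitely supported fields. [folklore] -/
theorem sub_form_nonneg (L : ℕ) [NeZero L] {k k' : ℕ} (hk : k ≤ k') (R : Finset (K (d + 1) (d + 1)))
    (w : K (d + 1) (d + 1) → ℝ) (hsupp : ∀ r, r ∉ R → w r = 0) :
    0 ≤ ∑ r ∈ R, ∑ s ∈ R, w r * (deltaZ L k' r s - deltaZ L k r s) * w s := by
  have h := deltaZ_form_mono_of_le L hk R w hsupp
  have e : ∑ r ∈ R, ∑ s ∈ R, w r * (deltaZ L k' r s - deltaZ L k r s) * w s =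
      (∑ r ∈ R, ∑ s ∈ R, w r * deltaZ L k' r s * w s) - ∑ r ∈ R, ∑ s ∈ R, w r * deltaZ L k r s * w s := by
    simp only [mul_sub, sub_mul, Finset.sum_sub_distrib]
  rw [e]
  linarith

/-- **THE DIAGONAL IS NON-DECREASING IN `k`**: `dDiag L k κ ≤ dDiag L k′ κ` for `k ≤ k′`. [folklore] -/
theorem dDiag_mono (L : ℕ) [NeZero L] {k k' : ℕ} (hk : k ≤ k') (κ : Fin (d + 1)) : dDiag L k κ ≤ dDiag L k' κ := by
  classical
  have h := sub_form_nonneg L hk {((0 : Fin (d + 1) → ℤ), κ)} (fun r => if r = ((0 : Fin (d + 1) → ℤ), κ) then 1 else 0)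
    (fun r hr => by rw [Finset.mem_singleton] at hr; simp [hr])
  simp only [Finset.sum_singleton, if_true, one_mul, mul_one] at h
  unfold dDiag
  linarith

/-- The diagonal is bounded: `|dDiag L k κ| ≤ c166Z d` (gan24-p2's `deltaZ_abs_le` at distance `0`). [folklore] -/
theorem abs_dDiag_le (L : ℕ) [NeZero L] (k : ℕ) (κ : Fin (d + 1)) : |dDiag L k κ| ≤ c166Z d := by
  have h := deltaZ_abs_le L k (((0 : Fin (d + 1) → ℤ), κ) : K (d + 1) (d + 1)) ((0 : Fin (d + 1) → ℤ), κ)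
  rw [dist_self, mul_zero, neg_zero, Real.exp_zero, mul_one] at h
  exact h

/-- **EVERY ENTRY OF THE INCREMENT `deltaZ L k′ − deltaZ L k` (`k ≤ k′`) IS BOUNDED BY THE DIAGONAL INCREMENTS**:
`|deltaZ L k′ x y − deltaZ L k x y| ≤ ((dDiag L k′ x.2 − dDiag L k x.2) + (dDiag L k′ y.2 − dDiag L k y.2))/2`. [folklore] -/
theorem abs_deltaZ_sub_le (L : ℕ) [NeZero L] {k k' : ℕ} (hk : k ≤ k') (x y : K (d + 1) (d + 1)) :
    |deltaZ L k' x y - deltaZ L k x y| ≤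
      ((dDiag L k' x.2 - dDiag L k x.2) + (dDiag L k' y.2 - dDiag L k y.2)) / 2 := by
  classical
  have h := abs_le_half_diag (fun r s => deltaZ L k' r s - deltaZ L k r s)
    (fun r s => by rw [deltaZ_symm L k' r s, deltaZ_symm L k r s]) (fun R w hw => sub_form_nonneg L hk R w hw) x y
  obtain ⟨x1, κ⟩ := x
  obtain ⟨y1, l⟩ := y
  simp only [deltaZ_diag_eq] at h
  exact h

/-- **ONE DATUM BOUNDS EVERY ENTRY OF EVERY LATER INCREMENT**: if `dDiag L k′ κ − dDiag L k κ ≤ η` for all `κ`, then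
`|deltaZ L k′ x y − deltaZ L k x y| ≤ η` for all bonds `x, y` (`k ≤ k′`). [folklore] -/
theorem abs_deltaZ_sub_le_of_datum (L : ℕ) [NeZero L] {k k' : ℕ} (hk : k ≤ k') {η : ℝ}
    (hdat : ∀ κ : Fin (d + 1), dDiag (d := d) L k' κ - dDiag L k κ ≤ η) (x y : K (d + 1) (d + 1)) :
    |deltaZ L k' x y - deltaZ L k x y| ≤ η := by
  have h := abs_deltaZ_sub_le L hk x y
  have h1 := hdat x.2
  have h2 := hdat y.2
  linarith

/-- The supremum of the diagonal over `k` (it exists: the diagonal is non-decreasing and bounded by `c166Z`); the limit against which the datum is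
certified. [folklore] -/
def dSup (L : ℕ) [NeZero L] (κ : Fin (d + 1)) : ℝ := ⨆ k : ℕ, dDiag L k κ

/-- `dDiag L k κ ≤ dSup L κ`. [folklore] -/
theorem dDiag_le_dSup (L : ℕ) [NeZero L] (k : ℕ) (κ : Fin (d + 1)) : dDiag L k κ ≤ dSup L κ :=
  le_ciSup (f := fun k : ℕ => dDiag L k κ) ⟨c166Z d, by
    rintro _ ⟨j, rfl⟩
    exact (le_abs_self _).trans (abs_dDiag_le L j κ)⟩ k

/-- The diagonal converges to `dSup` (monotone and bounded). [folklore] -/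
theorem tendsto_dDiag (L : ℕ) [NeZero L] (κ : Fin (d + 1)) : Tendsto (fun k : ℕ => dDiag L k κ) atTop (𝓝 (dSup L κ)) :=
  tendsto_atTop_ciSup (fun k k' hk => dDiag_mono L hk κ) ⟨c166Z d, by
    rintro _ ⟨j, rfl⟩
    exact (le_abs_self _).trans (abs_dDiag_le L j κ)⟩

section Wall

variable {Lc : ℕ} [NeZero Lc]

/-- **(MONO-K)₂ FOR THE MULTIPLIER BLOCK OF THE WALL'S RESOLVENT SLOT, FROM p3's DICTIONARY AND ONE DIAGONAL DATUM — NO RATE.**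
`MultDict Lc c` (gan24-p3's binder shape: the one-step-normalised multiplier block of `K_j^{(1)}` is `c·deltaZ Lc (j+1)` at coarse points, zero off them)
and the datum `dDiag Lc (j+1) κ − dDiag Lc (k₀+1) κ ≤ η₀` for all `j ≥ k₀`, all `κ` ⟹
`SupCauchyBand (j ↦ blockMM (unitResolvent Lc j)) (|c|·η₀) k₀`: all multiplier-block entries of `K_j^{(1)} − K_{j′}^{(1)}` (`j, j′ ≥ k₀`) are `≤ |c|·η₀`. [folklore] -/
theorem supCauchyBand_blockMM_of_multDict {c : ℝ} (hdict : MultDict Lc c) {k₀ : ℕ} {η₀ : ℝ}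
    (hdat : ∀ κ : Fin (3 + 1), ∀ j, k₀ ≤ j → dDiag (d := 3) Lc (j + 1) κ - dDiag Lc (k₀ + 1) κ ≤ η₀) :
    SupCauchyBand (fun j => blockMM (unitResolvent Lc j)) (|c| * η₀) k₀ := by
  have hη : 0 ≤ η₀ := by have := hdat 0 k₀ le_rfl; linarith
  -- the datum between any two levels beyond `k₀`
  have hpair : ∀ j j', k₀ ≤ j → j ≤ j' → ∀ x y : K (3 + 1) (3 + 1),
      |deltaZ Lc (j' + 1) x y - deltaZ Lc (j + 1) x y| ≤ η₀ := by
    intro j j' hj hjj' x y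
    refine abs_deltaZ_sub_le_of_datum Lc (Nat.succ_le_succ hjj') (fun κ => ?_) x y
    have h1 := hdat κ j' (hj.trans hjj')
    have h2 := dDiag_mono Lc (Nat.succ_le_succ hj) κ
    linarith
  intro j j' hj hj' x y a b
  have hE : 0 ≤ |c| * η₀ := mul_nonneg (abs_nonneg c) hη
  show |(blockMM (unitResolvent Lc j) - blockMM (unitResolvent Lc j')) x y a b| ≤ |c| * η₀
  simp only [Pi.sub_apply]
  rcases a with κ | κ <;> rcases b with l | l
  · simpa [blockMM] using hE
  · simpa [blockMM] using hE
  · simpa [blockMM] using hE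
  · simp only [blockMM]
    by_cases hx : Torus.proj Lc x = 0
    · by_cases hy : Torus.proj Lc y = 0
      · have hxu := eq_zsmul_quo_of_proj (N := Lc) hx
        have hyu := eq_zsmul_quo_of_proj (N := Lc) hy
        set u := quo Lc x
        set u' := quo Lc y
        rw [hxu, hyu, unitResolvent_inr_inr_coarse, unitResolvent_inr_inr_coarse, hdict.apply j κ l u u', hdict.apply j' κ l u u',
          ← mul_sub, abs_mul]
        refine mul_le_mul_of_nonneg_left ?_ (abs_nonneg c)
        rcases le_total j j' with hjj' | hjj'
        · rw [abs_sub_comm]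
          exact hpair j j' hj hjj' (u, κ) (u', l)
        · exact hpair j' j hj' hjj' (u, κ) (u', l)
      · rw [unitResolvent_inr_inr_off_right j x hy, unitResolvent_inr_inr_off_right j' x hy, sub_zero, abs_zero]; exact hE
    · rw [unitResolvent_inr_inr_off_left j hx, unitResolvent_inr_inr_off_left j' hx, sub_zero, abs_zero]; exact hE

/-- **THE SAME WITH THE DATUM CERTIFIED AGAINST THE LIMIT**: `dSup Lc κ − dDiag Lc (k₀+1) κ ≤ η₀` for all `κ` (ONE number per direction: the distance of
the step-`(k₀+1)` diagonal of `Δ` from its supremum = limit) ⟹ the multiplier block satisfies (MONO-K)₂ with constant `|c|·η₀` from `k₀`. [folklore] -/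
theorem supCauchyBand_blockMM_of_multDict_sup {c : ℝ} (hdict : MultDict Lc c) {k₀ : ℕ} {η₀ : ℝ}
    (hdat : ∀ κ : Fin (3 + 1), dSup (d := 3) Lc κ - dDiag Lc (k₀ + 1) κ ≤ η₀) :
    SupCauchyBand (fun j => blockMM (unitResolvent Lc j)) (|c| * η₀) k₀ :=
  supCauchyBand_blockMM_of_multDict hdict fun κ j _ => by
    have h := dDiag_le_dSup Lc (j + 1) κ
    have h2 := hdat κ
    linarith

end Wall

end Summit.QuantumFields.BalabanUV.Beta.GAN24.MonotoneMultiplier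

end
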